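import Literature.Geometry.Symplectic.ToroidalCoordinates
import Literature.Geometry.Symplectic.NearSymplecticPuncturedSphere
import HarnessLib

/-!
# Reduction of `relNearSymplecticTaubesTubes_exists` to Honda model charts along two circles

Topic `Literature/Geometry/Symplectic` (groundwork `--supports`
`Literature.Geometry.Symplectic.relNearSymplecticTaubesTubes_exists`; everything here is PROVED,
no named fact is introduced).

The named fact `relNearSymplecticTaubesTubes_exists` (`NearSymplecticPuncturedSphere.lean`) packages
the END RESULT of four published steps (its docstring, steps 1–5).  Steps 1–3 — Gerig 2021
Thm. 1.6 (asymptotically standard near-symplectic forms on `Σ ∖ p`), the Luttinger–Perutz–Taubes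
modifications to exactly two untwisted zero circles (Gerig 2021 §1, §3; Perutz 2006 Thm. 1.4,
1.8), and Honda's normal form along an untwisted circle (Honda 2004 §4 Thm. 5; Perutz 2006
Lemma 3.1) — produce, in the language of the sources, the following data on `X = Σ ∖ p`:

> a smooth closed `2`-form `ω` on `X`, equal to the standard form at the end, non-degenerate off
> two disjointly embedded circles `Z₁, Z₂`, and tubular coordinates
> `(θ, x₁, x₂, x₃) ∈ S¹ × B³(r)` about each `Zᵢ` in which `ω = ω_A = dθ ∧ dQ + ⋆₃ dQ`
> (Gerig 2021, §3, first paragraph, with `N = 2`; Honda 2004, Thm. 4 (A)).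

This file formalizes that sentence as the predicate `IsHondaModelChart` (a `2π`-periodic map
`χ : ℝ_θ × ℝ³ → Σ ∖ p` which on the model tube `ℝ × B³(r)` is smooth, immersive, injective
modulo `2πℤ · e_θ` — i.e. an embedding of `(ℝ/2πℤ) × B³(r)` —, avoids the punctured chart-ball
and pulls `sf` back to `hondaFormA`), and PROVES step 4 of the docstring (toroidal coordinates):

* `exists_taubesTubes_of_hondaModelCharts` — from two disjoint Honda model charts of a form that
  is non-degenerate off the two circles `χᵢ(ℝ × 0)` one gets the two Taubes tubes of the named fact
  (`Ψᵢ := χᵢ ∘ T`, `T` the toroidal coordinate map of `ToroidalCoordinates.lean`; smoothness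
  across the cut of `arg` by the `2π`-periodicity of `χᵢ` and the second branch `T'`;
  `Ψᵢ* sf = T*ω_A = formT` by `hondaFormA_eq_untwistedTubeForm`; the tubes are disjoint, avoid
  the ball, and `Ψᵢ(C₀) ⊇ χᵢ(ℝ × 0)`), for any manifold `M` charted on `ℝ⁴` and `p ∈ M`;
* `relNearSymplecticTaubesTubes_exists_of_hondaModelCharts` — hence the named fact follows from
  the existence, for every homotopy `4`-sphere `Σ` and `p ∈ Σ`, of an asymptotically standard
  smooth closed `2`-form on `Σ ∖ p` with two disjoint Honda model charts off which it is
  non-degenerate (= the output of steps 1–3, stated in the printed vocabulary).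

What remains for `relNearSymplecticTaubesTubes_exists_holds` is exactly that existence statement
(Gerig 2021 Thm. 1.6 + §3 par. 1; `L²`-Hodge theory on the cylindrical-end completion, Honda's
transversality, the circle surgeries and Honda's Moser-type normal form), none of whose analytic
infrastructure is in Mathlib or the tree yet; it is NOT restated here as a named fact (D-0026).

## References

* C. Gerig, *No homotopy 4-sphere invariants using ECH=SWF*, Algebr. Geom. Topol. 21 (2021),
  Thm. 1.6, §1, §3 [Gerig2021NoHomotopySphereInvariants].
* K. Honda, *Local properties of self-dual harmonic 2-forms on a 4-manifold*, J. reine angew.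
  Math. 577 (2004), §4 Thm. 4 (A), Thm. 5 [Honda2004LocalSD].
* T. Perutz, *Zero-sets of near-symplectic forms*, J. Symplectic Geom. 4 (2006), Thm. 1.4,
  Lemma 3.1 [Perutz2006].
* C. H. Taubes, Geom. Topol. 2 (1998), eq. (1.1), §1.c [Taubes1998S1B3].
-/

noncomputable section

open scoped Manifold ContDiff Topology Real
open Set Complex Filter Literature.Geometry.Kaehler

namespace Literature.Geometry.Symplectic

/-- Local notation for the model space `ℝ⁴ = EuclideanSpace ℝ (Fin 4)`. -/
local notation "E4" => EuclideanSpace ℝ (Fin 4)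

section Manifold

variable {M : Type*} [TopologicalSpace M] [ChartedSpace E4 M] [T1Space M]

/-! ### Honda model charts and Taubes tubes -/

/-- **A Honda model chart of radius `r` for the `2`-form `sf` on `M ∖ p`, off the punctured
`ε`-chart-ball**: a map `χ : ℝ_θ × ℝ³ → M ∖ p`, `2π`-periodic in `θ = q 0`, which on the model
tube `ℝ × B³(r) = hondaTube r` is smooth, injective modulo `2πℤ · e_θ` and immersive (so that it
descends to an embedding of the solid torus `(ℝ/2πℤ) × B³(r)` onto a tubular neighbourhood of the
circle `χ(ℝ × 0)`), avoids the punctured `ε`-chart-ball about `p`, and pulls `sf` back to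
Honda's untwisted model: `sf (χ q) (dχ U, dχ V) = ω_A(q)(U, V)`.  This is the conclusion of
Honda 2004, §4 Thm. 5 (normal form (A), up to the sign handled by `(θ, x₃) ↦ (−θ, −x₃)`) for an
untwisted zero circle of a near-symplectic form, in the form used by Gerig 2021, §3 ("choose
local coordinates `(t, x₁, x₂, x₃) ∈ S¹ × B³` … so that `ω = dt ∧ dQ + ⋆dQ`").
[cite: Honda2004LocalSD, §4 Thm. 4 (A) and Thm. 5] -/
structure IsHondaModelChart (p : M) (ε r : ℝ) (sf : MForm (𝓡 4) (punctured p) ℝ 2)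
    (χ : E4 → punctured p) : Prop where
  /-- `χ` is `2π`-periodic in the angular coordinate. -/
  periodic : ∀ q : E4, χ (q + (2 * π) • EuclideanSpace.single 0 1) = χ q
  /-- `χ` is smooth on the model tube. -/
  contMDiffOn : ContMDiffOn 𝓘(ℝ, E4) (𝓡 4) ∞ χ (hondaTube r)
  /-- `χ` is injective on the model tube modulo the period lattice `2πℤ · e_θ`. -/
  eq_add_of_eq : ∀ q ∈ hondaTube r, ∀ q' ∈ hondaTube r, χ q' = χ q →
    ∃ k : ℤ, q' = q + (2 * π * k) • EuclideanSpace.single 0 1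
  /-- `χ` is an immersion on the model tube. -/
  injective_mfderiv : ∀ q ∈ hondaTube r, Function.Injective (mfderiv 𝓘(ℝ, E4) (𝓡 4) χ q)
  /-- The image of the model tube avoids the punctured `ε`-chart-ball about `p`. -/
  not_inPuncturedChartBall : ∀ q ∈ hondaTube r, ¬ InPuncturedChartBall p ε (χ q)
  /-- `χ* sf = ω_A` on the model tube. -/
  pullback_eq : ∀ q ∈ hondaTube r, ∀ U V : E4,
    sf (χ q) ![mfderiv 𝓘(ℝ, E4) (𝓡 4) χ q U, mfderiv 𝓘(ℝ, E4) (𝓡 4) χ q V] = hondaFormA q U V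

/-- **An (untwisted) Taubes tube of `sf` of radius `δ` off the punctured `ε`-ball** — verbatim
the `let IsTube` of `relNearSymplecticTaubesTubes_exists` with its `let`s named
(`flatSolidTorus`, `untwistedTubeForm`): `Ψ : ℝ⁴ → M ∖ p` is, on the flat solid torus `U_δ`,
a smooth injective immersion avoiding the punctured `ε`-chart-ball with `Ψ* sf = formT`.
[cite: Taubes1998S1B3, eq. (1.1) and §1.c] -/
def IsUntwistedTaubesTube (p : M) (ε δ : ℝ) (sf : MForm (𝓡 4) (punctured p) ℝ 2)
    (Ψ : E4 → punctured p) : Prop :=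
  ContMDiffOn 𝓘(ℝ, E4) (𝓡 4) ∞ Ψ (flatSolidTorus δ) ∧ Set.InjOn Ψ (flatSolidTorus δ) ∧
    (∀ y ∈ flatSolidTorus δ, Function.Injective (mfderiv 𝓘(ℝ, E4) (𝓡 4) Ψ y)) ∧
    (∀ y ∈ flatSolidTorus δ, ¬ InPuncturedChartBall p ε (Ψ y)) ∧
    (∀ y ∈ flatSolidTorus δ, ∀ u v : E4,
      sf (Ψ y) ![mfderiv 𝓘(ℝ, E4) (𝓡 4) Ψ y u, mfderiv 𝓘(ℝ, E4) (𝓡 4) Ψ y v] =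
        untwistedTubeForm y u v)

/-- The model tube is open. [folklore] -/
theorem isOpen_hondaTube (r : ℝ) : IsOpen (hondaTube r) := by
  have : Continuous fun q : E4 => q 1 ^ 2 + q 2 ^ 2 + q 3 ^ 2 := by fun_prop
  exact isOpen_lt this continuous_const

/-- Smaller model tubes lie in larger ones. [folklore] -/
theorem hondaTube_mono {r r' : ℝ} (hr : 0 ≤ r) (h : r ≤ r') : hondaTube r ⊆ hondaTube r' :=
  fun _ hq => lt_of_lt_of_le (mem_hondaTube.1 hq) (pow_le_pow_left₀ hr h 2)

namespace IsHondaModelChart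

variable {p : M} {ε r : ℝ} {sf : MForm (𝓡 4) (punctured p) ℝ 2} {χ : E4 → punctured p}

/-- Periodicity under the whole lattice `2πℤ · e_θ`. [folklore] -/
theorem periodic_int (h : IsHondaModelChart p ε r sf χ) (q : E4) (k : ℤ) :
    χ (q + (2 * π * k) • EuclideanSpace.single 0 1) = χ q := by
  induction k using Int.induction_on generalizing q with
  | zero => simp
  | succ n ih =>
    have := h.periodic (q + (2 * π * (n : ℤ)) • EuclideanSpace.single 0 1)
    rw [add_assoc, ← add_smul] at this
    push_cast at this ih ⊢
    rw [show 2 * π * (n + 1 : ℝ) = 2 * π * n + 2 * π by ring, this, ih]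
  | pred n ih =>
    have := h.periodic (q + (2 * π * ((-(n : ℤ) - 1 : ℤ) : ℝ)) • EuclideanSpace.single 0 1)
    rw [add_assoc, ← add_smul] at this
    push_cast at this ih ⊢
    rw [show 2 * π * (-(n : ℝ) - 1) + 2 * π = 2 * π * (-n) by ring] at this
    rw [← this, ih]

/-- `χ` is smooth at every point of the (open) model tube. [folklore] -/
theorem contMDiffAt (h : IsHondaModelChart p ε r sf χ) {q : E4} (hq : q ∈ hondaTube r) :
    ContMDiffAt 𝓘(ℝ, E4) (𝓡 4) ∞ χ q :=
  h.contMDiffOn.contMDiffAt ((isOpen_hondaTube r).mem_nhds hq)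

/-- **The derivative of `χ` is `2πℤ · e_θ`-periodic on the model tube** (chain rule applied to
`χ ∘ (· + 2πk e_θ) = χ`). [folklore] -/
theorem mfderiv_add_int (h : IsHondaModelChart p ε r sf χ) {q : E4} (hq : q ∈ hondaTube r)
    (k : ℤ) :
    mfderiv 𝓘(ℝ, E4) (𝓡 4) χ (q + (2 * π * k) • EuclideanSpace.single 0 1) =
      mfderiv 𝓘(ℝ, E4) (𝓡 4) χ q := by
  set v : E4 := (2 * π * k) • EuclideanSpace.single 0 1 with hv
  have hper : χ ∘ (fun x : E4 => x + v) = χ := funext fun x => h.periodic_int x k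
  have hq' : q + v ∈ hondaTube r := add_smul_single_mem_hondaTube hq _
  have hχ : MDifferentiableAt 𝓘(ℝ, E4) (𝓡 4) χ (q + v) :=
    (h.contMDiffAt hq').mdifferentiableAt (by simp)
  have hτ : HasMFDerivAt 𝓘(ℝ, E4) 𝓘(ℝ, E4) (fun x : E4 => x + v) q
      (ContinuousLinearMap.id ℝ E4) :=
    ((hasFDerivAt_id q).add_const v).hasMFDerivAt
  have hc := hχ.hasMFDerivAt.comp q hτ
  rw [hper] at hc
  ext1 u
  exact (DFunLike.congr_fun hc.mfderiv u).symm

/-- **Shrinking the radius** keeps a Honda model chart. [folklore] -/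
theorem mono_radius (h : IsHondaModelChart p ε r sf χ) {r' : ℝ} (hr' : 0 ≤ r') (hle : r' ≤ r) :
    IsHondaModelChart p ε r' sf χ where
  periodic := h.periodic
  contMDiffOn := h.contMDiffOn.mono (hondaTube_mono hr' hle)
  eq_add_of_eq q hq q' hq' := h.eq_add_of_eq q (hondaTube_mono hr' hle hq) q'
    (hondaTube_mono hr' hle hq')
  injective_mfderiv q hq := h.injective_mfderiv q (hondaTube_mono hr' hle hq)
  not_inPuncturedChartBall q hq := h.not_inPuncturedChartBall q (hondaTube_mono hr' hle hq)
  pullback_eq q hq := h.pullback_eq q (hondaTube_mono hr' hle hq)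

/-- **Shrinking the ball** keeps a Honda model chart (a smaller punctured chart-ball is avoided a
fortiori). [folklore] -/
theorem mono_ball (h : IsHondaModelChart p ε r sf χ) {ε' : ℝ} (hle : ε' ≤ ε) :
    IsHondaModelChart p ε' r sf χ where
  periodic := h.periodic
  contMDiffOn := h.contMDiffOn
  eq_add_of_eq := h.eq_add_of_eq
  injective_mfderiv := h.injective_mfderiv
  not_inPuncturedChartBall q hq hb :=
    h.not_inPuncturedChartBall q hq ⟨hb.1, Metric.ball_subset_ball hle hb.2⟩
  pullback_eq := h.pullback_eq

end IsHondaModelChart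

/-! ### The tube `Ψ = χ ∘ T` of a Honda model chart -/

section Tube

variable {p : M} {ε r δ : ℝ} {sf : MForm (𝓡 4) (punctured p) ℝ 2} {χ : E4 → punctured p}

/-- **Local representation of `χ ∘ T` by a smooth branch.**  At a point `y` off the axis,
`χ ∘ T` agrees near `y` with `χ ∘ B` for a branch `B ∈ {T, T'}` that is `C^∞` at `y` with
derivative `dT_y` and `B y = T y + 2πk e_θ`. [folklore] -/
theorem exists_branch (h : IsHondaModelChart p ε r sf χ) {y : E4} (hy : 0 < toroidalR y) :
    ∃ (B : E4 → E4) (k : ℤ), (fun y' => χ (toroidalMap y')) =ᶠ[𝓝 y] (fun y' => χ (B y')) ∧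
      ContDiffAt ℝ ∞ B y ∧ HasFDerivAt B (toroidalDeriv y) y ∧
      B y = toroidalMap y + (2 * π * k) • EuclideanSpace.single 0 1 := by
  rcases Complex.mem_slitPlane_or_neg_mem_slitPlane (toroidalZ_ne_zero hy) with hz | hz
  · exact ⟨toroidalMap, 0, Eventually.of_forall fun _ => rfl, contDiffAt_toroidalMap hz,
      hasFDerivAt_toroidalMap hz, by simp⟩
  · obtain ⟨k, hk⟩ := toroidalMap'_eq_toroidalMap_add hy
    refine ⟨toroidalMap', k, ?_, contDiffAt_toroidalMap' hz, hasFDerivAt_toroidalMap' hz, hk⟩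
    -- near `y`, `-z` stays in the (open) slit plane, hence off the axis, and `T' = T + 2πk' e_θ`
    have hopen : ∀ᶠ y' in 𝓝 y, -toroidalZ y' ∈ slitPlane :=
      (contDiff_toroidalZ (n := 0)).continuous.neg.continuousAt.eventually
        (isOpen_slitPlane.mem_nhds hz)
    filter_upwards [hopen] with y' hy'
    have hr' : 0 < toroidalR y' := by
      rw [← norm_toroidalZ, norm_pos_iff, ← neg_ne_zero]; exact slitPlane_ne_zero hy'
    obtain ⟨k', hk'⟩ := toroidalMap'_eq_toroidalMap_add hr'
    change χ (toroidalMap y') = χ (toroidalMap' y')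
    rw [hk', h.periodic_int]

/-- `T` maps the flat solid torus of radius `δ ≤ r` into the model tube of radius `r`. [folklore] -/
theorem toroidalMap_mem_hondaTube_of_le (hδ : 0 ≤ δ) (hδr : δ ≤ r) {y : E4}
    (hy : y ∈ flatSolidTorus δ) : toroidalMap y ∈ hondaTube r :=
  hondaTube_mono hδ hδr (toroidalMap_mem_hondaTube hy)

/-- **`Ψ = χ ∘ T` is smooth on the flat solid torus** (`δ ≤ min r 1`). [folklore] -/
theorem contMDiffAt_comp_toroidalMap (h : IsHondaModelChart p ε r sf χ) (hδ : 0 ≤ δ)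
    (hδ1 : δ ≤ 1) (hδr : δ ≤ r) {y : E4} (hy : y ∈ flatSolidTorus δ) :
    ContMDiffAt 𝓘(ℝ, E4) (𝓡 4) ∞ (fun y' => χ (toroidalMap y')) y := by
  have hr := toroidalR_pos_of_mem_flatSolidTorus hδ hδ1 hy
  obtain ⟨B, k, hB, hBs, -, hBy⟩ := exists_branch h hr
  have hq : B y ∈ hondaTube r := by
    rw [hBy]; exact add_smul_single_mem_hondaTube (toroidalMap_mem_hondaTube_of_le hδ hδr hy) _
  have hcomp : ContMDiffAt 𝓘(ℝ, E4) (𝓡 4) ∞ (χ ∘ B) y :=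
    (h.contMDiffAt hq).comp y (contMDiffAt_iff_contDiffAt.2 hBs)
  exact hcomp.congr_of_eventuallyEq hB

/-- **The derivative of `Ψ = χ ∘ T` on the flat solid torus**: `dΨ_y = dχ_{T y} ∘ dT_y`.
[folklore] -/
theorem hasMFDerivAt_comp_toroidalMap (h : IsHondaModelChart p ε r sf χ) (hδ : 0 ≤ δ)
    (hδ1 : δ ≤ 1) (hδr : δ ≤ r) {y : E4} (hy : y ∈ flatSolidTorus δ) :
    HasMFDerivAt 𝓘(ℝ, E4) (𝓡 4) (fun y' => χ (toroidalMap y')) y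
      ((mfderiv 𝓘(ℝ, E4) (𝓡 4) χ (toroidalMap y)).comp (toroidalDeriv y)) := by
  have hr := toroidalR_pos_of_mem_flatSolidTorus hδ hδ1 hy
  obtain ⟨B, k, hB, hBs, hBd, hBy⟩ := exists_branch h hr
  have hTq : toroidalMap y ∈ hondaTube r := toroidalMap_mem_hondaTube_of_le hδ hδr hy
  have hq : B y ∈ hondaTube r := by rw [hBy]; exact add_smul_single_mem_hondaTube hTq _
  have hχ : MDifferentiableAt 𝓘(ℝ, E4) (𝓡 4) χ (B y) :=
    (h.contMDiffAt hq).mdifferentiableAt (by simp)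
  have hc : HasMFDerivAt 𝓘(ℝ, E4) (𝓡 4) (χ ∘ B) y
      ((mfderiv 𝓘(ℝ, E4) (𝓡 4) χ (B y)).comp (toroidalDeriv y)) :=
    hχ.hasMFDerivAt.comp y hBd.hasMFDerivAt
  rw [hBy, h.mfderiv_add_int hTq] at hc
  exact hc.congr_of_eventuallyEq hB

/-- `dΨ_y = dχ_{T y} ∘ dT_y` as an equation for `mfderiv`. [folklore] -/
theorem mfderiv_comp_toroidalMap (h : IsHondaModelChart p ε r sf χ) (hδ : 0 ≤ δ)
    (hδ1 : δ ≤ 1) (hδr : δ ≤ r) {y : E4} (hy : y ∈ flatSolidTorus δ) :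
    mfderiv 𝓘(ℝ, E4) (𝓡 4) (fun y' => χ (toroidalMap y')) y =
      (mfderiv 𝓘(ℝ, E4) (𝓡 4) χ (toroidalMap y)).comp (toroidalDeriv y) :=
  (hasMFDerivAt_comp_toroidalMap h hδ hδ1 hδr hy).mfderiv

/-- **`Ψ = χ ∘ T` is an untwisted Taubes tube** of radius `δ ≤ min r 1`: smooth, injective and
immersive on `U_δ`, off the punctured ball, with `Ψ* sf = T* χ* sf = T*ω_A = formT`.
[cite: Taubes1998S1B3, eq. (1.1) and §1.c] -/
theorem isUntwistedTaubesTube_comp_toroidalMap (h : IsHondaModelChart p ε r sf χ) (hδ : 0 ≤ δ)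
    (hδ1 : δ ≤ 1) (hδr : δ ≤ r) :
    IsUntwistedTaubesTube p ε δ sf (fun y => χ (toroidalMap y)) := by
  refine ⟨fun y hy => (contMDiffAt_comp_toroidalMap h hδ hδ1 hδr hy).contMDiffWithinAt,
    ?_, ?_, ?_, ?_⟩
  · -- injective: `χ` injective mod `2πℤ e_θ`, `T` injective mod `2πℤ e_θ`
    intro y hy y' hy' hyy
    obtain ⟨k, hk⟩ := h.eq_add_of_eq _ (toroidalMap_mem_hondaTube_of_le hδ hδr hy) _
      (toroidalMap_mem_hondaTube_of_le hδ hδr hy') hyy.symm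
    exact (eq_of_toroidalMap_eq_add hk).symm
  · -- immersive: `dΨ_y = dχ_{T y} ∘ dT_y`, both injective
    intro y hy
    rw [mfderiv_comp_toroidalMap h hδ hδ1 hδr hy]
    exact (h.injective_mfderiv _ (toroidalMap_mem_hondaTube_of_le hδ hδr hy)).comp
      (toroidalDeriv_injective (toroidalR_pos_of_mem_flatSolidTorus hδ hδ1 hy))
  · exact fun y hy => h.not_inPuncturedChartBall _ (toroidalMap_mem_hondaTube_of_le hδ hδr hy)
  · intro y hy u v
    rw [mfderiv_comp_toroidalMap h hδ hδ1 hδr hy]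
    exact (h.pullback_eq _ (toroidalMap_mem_hondaTube_of_le hδ hδr hy) (toroidalDeriv y u)
      (toroidalDeriv y v)).trans
      (hondaFormA_eq_untwistedTubeForm rfl rfl rfl rfl rfl rfl rfl rfl rfl rfl rfl)

omit [ChartedSpace E4 M] in
/-- The tube image lies in the image of the model tube. [folklore] -/
theorem image_comp_toroidalMap_subset (hδ : 0 ≤ δ) (hδr : δ ≤ r) (χ : E4 → punctured p) :
    (fun y => χ (toroidalMap y)) '' flatSolidTorus δ ⊆ χ '' hondaTube r := by
  rintro _ ⟨y, hy, rfl⟩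
  exact ⟨toroidalMap y, toroidalMap_mem_hondaTube_of_le hδ hδr hy, rfl⟩

/-- **The image of the core circle is the image of the axis**: `χ(ℝ × 0) ⊆ Ψ(C₀)`
(`2π`-periodicity of `χ` and `exists_toroidalMap_eq_of_mem_hondaAxis`). [folklore] -/
theorem image_hondaAxis_subset (h : IsHondaModelChart p ε r sf χ) :
    χ '' hondaAxis ⊆ (fun y => χ (toroidalMap y)) '' flatCoreCircle := by
  rintro _ ⟨q, hq, rfl⟩
  obtain ⟨y, hy, k, hk⟩ := exists_toroidalMap_eq_of_mem_hondaAxis hq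
  exact ⟨y, hy, by simp only [hk, h.periodic_int]⟩

end Tube

/-! ### The reduction -/

/-- **Two disjoint Honda model charts give the two Taubes tubes of the named fact.**  Let `sf`
be a `2`-form on `M ∖ p` with Honda model charts `χ₁, χ₂` of radius `r` off the punctured
`ε`-ball whose tube images are disjoint, and suppose `sf` is non-degenerate off the two circles
`χᵢ(ℝ × 0)`.  Then for `δ = min r (1/2)` the maps `Ψᵢ = χᵢ ∘ T` are untwisted Taubes tubes of
radius `δ`, `0 < δ < 1`, with disjoint images, and `sf` is non-degenerate off the two core circles
`Ψᵢ(C₀)` (docstring step 4 of `relNearSymplecticTaubesTubes_exists`: flat toroidal coordinates,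
`T*ω_A = formT`). [cite: Taubes1998S1B3, eq. (1.1) and §1.c] -/
theorem exists_taubesTubes_of_hondaModelCharts (p : M) {ε r : ℝ}
    {sf : MForm (𝓡 4) (punctured p) ℝ 2} {χ₁ χ₂ : E4 → punctured p} (hr : 0 < r)
    (h₁ : IsHondaModelChart p ε r sf χ₁) (h₂ : IsHondaModelChart p ε r sf χ₂)
    (hdisj : Disjoint (χ₁ '' hondaTube r) (χ₂ '' hondaTube r))
    (hnd : ∀ x : punctured p, x ∉ χ₁ '' hondaAxis ∪ χ₂ '' hondaAxis →
      ∀ v : TangentSpace (𝓡 4) x, v ≠ 0 → ∃ w : TangentSpace (𝓡 4) x, sf x ![v, w] ≠ 0) :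
    ∃ (δ : ℝ) (Ψ₁ Ψ₂ : E4 → punctured p), 0 < δ ∧ δ < 1 ∧
      IsUntwistedTaubesTube p ε δ sf Ψ₁ ∧ IsUntwistedTaubesTube p ε δ sf Ψ₂ ∧
      Disjoint (Ψ₁ '' flatSolidTorus δ) (Ψ₂ '' flatSolidTorus δ) ∧
      ∀ x : punctured p, x ∉ Ψ₁ '' flatCoreCircle ∪ Ψ₂ '' flatCoreCircle →
        ∀ v : TangentSpace (𝓡 4) x, v ≠ 0 → ∃ w : TangentSpace (𝓡 4) x, sf x ![v, w] ≠ 0 := by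
  set δ : ℝ := min r (1 / 2) with hδ_def
  have hδ : 0 < δ := lt_min hr (by norm_num)
  have hδ1 : δ < 1 := lt_of_le_of_lt (min_le_right _ _) (by norm_num)
  have hδr : δ ≤ r := min_le_left _ _
  refine ⟨δ, fun y => χ₁ (toroidalMap y), fun y => χ₂ (toroidalMap y), hδ, hδ1,
    isUntwistedTaubesTube_comp_toroidalMap h₁ hδ.le hδ1.le hδr,
    isUntwistedTaubesTube_comp_toroidalMap h₂ hδ.le hδ1.le hδr,
    hdisj.mono (image_comp_toroidalMap_subset hδ.le hδr χ₁)
      (image_comp_toroidalMap_subset hδ.le hδr χ₂), ?_⟩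
  intro x hx v hv
  refine hnd x (fun hx' => hx ?_) v hv
  rcases hx' with hx' | hx'
  · exact Or.inl (image_hondaAxis_subset h₁ hx')
  · exact Or.inr (image_hondaAxis_subset h₂ hx')

end Manifold

/-- **`relNearSymplecticTaubesTubes_exists` follows from the existence of asymptotically standard
forms with two disjoint Honda model charts** (the printed output of Gerig 2021 Thm. 1.6 + §3
par. 1 and Honda 2004 Thm. 5 on `Σ ∖ p`): if for every homotopy `4`-sphere `Σ` and `p ∈ Σ` there
are `ε > 0` with `closedBall (e p) ε ⊆ e.target`, `r > 0`, a smooth closed `2`-form `sf` on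
`Σ ∖ p` standard on the punctured `ε`-chart-ball, and two Honda model charts of radius `r` off
that ball with disjoint tube images, `sf` being non-degenerate off the two circles `χᵢ(ℝ × 0)`,
then the named fact holds (with the tubes `Ψᵢ = χᵢ ∘ T` of
`exists_taubesTubes_of_hondaModelCharts`).  This discharges docstring steps 4–5 of the fact;
steps 1–3 are the hypothesis. [cite: Gerig2021NoHomotopySphereInvariants, Thm. 1.6 and §3 (first par.)] -/
theorem relNearSymplecticTaubesTubes_exists_of_hondaModelCharts
    (H : ∀ (S : Literature.Topology.FourManifolds.HomotopySphere 4) (p : S.carrier),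
      ∃ (ε r : ℝ) (sf : MForm (𝓡 4) (punctured p) ℝ 2) (χ₁ χ₂ : E4 → punctured p),
        0 < ε ∧ Metric.closedBall (extChartAt (𝓡 4) p p) ε ⊆ (extChartAt (𝓡 4) p).target ∧
        0 < r ∧ IsSmoothForm sf ∧ IsClosedForm sf ∧ IsStandardOnBall p ε sf ∧
        IsHondaModelChart p ε r sf χ₁ ∧ IsHondaModelChart p ε r sf χ₂ ∧
        Disjoint (χ₁ '' hondaTube r) (χ₂ '' hondaTube r) ∧
        ∀ x : punctured p, x ∉ χ₁ '' hondaAxis ∪ χ₂ '' hondaAxis →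
          ∀ v : TangentSpace (𝓡 4) x, v ≠ 0 → ∃ w : TangentSpace (𝓡 4) x, sf x ![v, w] ≠ 0) :
    relNearSymplecticTaubesTubes_exists := by
  intro S p
  obtain ⟨ε, r, sf, χ₁, χ₂, hε, hball, hr, hsm, hcl, hstd, h₁, h₂, hdisj, hnd⟩ := H S p
  obtain ⟨δ, Ψ₁, Ψ₂, hδ, hδ1, hT₁, hT₂, hdisj', hnd'⟩ :=
    exists_taubesTubes_of_hondaModelCharts p hr h₁ h₂ hdisj hnd
  exact ⟨ε, δ, sf, Ψ₁, Ψ₂, hε, hball, hδ, hδ1, hsm, hcl, hstd, hT₁, hT₂, hdisj', hnd'⟩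

end Literature.Geometry.Symplectic

end
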